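import Summits.QuantumFields.YangMills.Theorems.EquipartitionCriticalityFreeEnergyLogCoefficientStubExpChartPackage
import Summits.QuantumFields.YangMills.Theorems.EquipartitionCriticalityFreeEnergyLogCoefficientStubWeakCoupling
import Literature.Analysis.Asymptotics.LaplacePowerLogAbelian

/-!
# Route `LangevinControlUV`, crux `FemtoCurvatureTwoPointC` (stmt-QuantumFields-16204), line `birth` —
# the one-link Laplace bound `z(β) ≤ C β^{-D/2}`

Registered wave-2 sub-goal `oneLinkLaplace_le_rpow` (`--supports stmt-QuantumFields-16204`), proved
verbatim. Setting: a compact second-countable group `G` with a faithful continuous unitary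
representation `ρ : G →* M_N(ℂ)`, `σ = haarProbability G` its Haar probability measure,
`D = dimE ρ` the real dimension of the Lie algebra of `ρ(G)` (exponential chart package of crux
`FreeEnergyLogCoefficient`, namespace `…Theorems.FreeEnergyLogCoefficient`), and the Hilbert–Schmidt
(Frobenius) norm on `M_N(ℂ)` (`open scoped Matrix.Norms.Frobenius`, as in the chart files).

**Statement.** There is `C > 0` with

  `z(β) := ∫_G e^{−β (N − Re tr ρ(g))} dσ(g) ≤ C · β^{−D/2}`   for every `β ≥ 1`.

**Why.** The crux's variance-ceiling stub reduces (p141044, p141134) to an `L`-UNIFORM torus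
free-energy doubling `Z_L(β/2) ≤ e^{A L⁴} Z_L(β)`, proved by a torus partition-function sandwich whose
elementary factor is this ONE-LINK (one-plaquette) Gaussian upper bound: the single-plaquette weight
integrates to `O(β^{−D/2})` because the action `N − Re tr ρ(g) = ‖ρ g − 1‖²/2` is quadratic in the
Hilbert–Schmidt distance to `1` and Haar measure of the Hilbert–Schmidt ball `B(1, δ)` is `O(δ^D)`.

**Proof.**
* `exists_haar_gball_le` — the SMALL-BALL UPPER BOUND `σ(B(1,δ)) ≤ C₂ δ^D` for ALL `δ > 0`
  (the upper half of the two-sided small-ball estimate; for `U(N)` with `D = N²` this is Chatterjee,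
  arXiv:1602.01222, Cor. 6.3 / Thm. 11.1, here with a soft constant): for small `δ` the ratio
  `σ(B(1,δ))/vol(b(0,δ))` tends to the soft Haar constant `haarConstE ρ < ∞` (`haarConstE_spec`, LANDED
  in `…FreeEnergyLogCoefficientExpChartMeasure`), so it is eventually `≤ haarConstE ρ + 1`, and
  `vol(b(0,δ)) = δ^D vol(b(0,1))`; for large `δ ≥ δ₀`, `σ ≤ 1 ≤ (δ/δ₀)^D`.
* LAYER CAKE (`Literature.Analysis.Asymptotics.LaplacePowerLog.integral_exp_neg_mul_eq`):
  `z(β) = ∫₀^∞ e^{−u} σ{S ≤ u/β} du` with `S(g) = N − Re tr ρ(g) = ‖ρ g − 1‖²/2 ≥ 0`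
  (`WeakCoupling.sub_re_trace_eq`), and `{S ≤ u/β} ⊆ B(1, √(2u/β))`, so
  `z(β) ≤ ∫₀^∞ e^{−u} C₂ (2u/β)^{D/2} du = C₂ 2^{D/2} Γ(D/2 + 1) β^{−D/2}`
  (`LaplacePowerLog.integral_const_mul_rpow_mul_exp_neg`).

Everything here is proved from Mathlib and the tree (no named facts, no new definitions). The
small-ball upper bound is exported separately (`exists_haar_gball_le`, companion of the package's lower
bound `FreeEnergyLogCoefficient.exists_haar_gball_ge`) for reuse by the other factors of the sandwich.
-/

set_option autoImplicit false

noncomputable section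

open scoped Matrix Matrix.Norms.Frobenius Topology ENNReal NNReal
open MeasureTheory Filter Set Metric
open Literature.MathematicalPhysics.QuantumFieldTheory
open Literature.Analysis.Asymptotics
open Summit.QuantumFields.YangMills.Theorems.FreeEnergyLogCoefficient

namespace Summit.QuantumFields.YangMills.Theorems.FemtoCurvatureTwoPointC

section SmallBall

variable {N : ℕ} {G : Type*} [Group G] [TopologicalSpace G] [IsTopologicalGroup G] [CompactSpace G]
  [MeasurableSpace G] [BorelSpace G] (ρ : G →* Matrix (Fin N) (Fin N) ℂ)

/-- **Small balls have Haar measure `≤ C δ^D`, all radii** (upper half of the two-sided small-ball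
estimate; Chatterjee arXiv:1602.01222 Cor. 6.3 / Thm. 11.1 for `U(N)`, here for a compact group with a
faithful continuous unitary representation `ρ` and a soft constant): there is `C > 0` with
`σ{g | ‖ρ g − 1‖ ≤ δ} ≤ C δ^D` for every `δ > 0`, `D = dimE ρ`. For small `δ` this is the finiteness
of the soft Haar constant `lim_{δ→0⁺} σ(B(1,δ))/vol(b(0,δ))` (`haarConstE_spec`) and
`vol(b(0,δ)) = δ^D vol(b(0,1))`; for `δ ≥ δ₀` it is `σ ≤ 1 ≤ (δ/δ₀)^D`. [folklore] -/
theorem exists_haar_gball_le (hρ : Continuous ρ) (hinj : Function.Injective ρ)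
    (hU : ∀ g, ρ g ∈ Matrix.unitaryGroup (Fin N) ℂ) :
    ∃ C : ℝ, 0 < C ∧ ∀ δ : ℝ, 0 < δ →
      haarProbability G {g : G | ‖ρ g - 1‖ ≤ δ} ≤ ENNReal.ofReal (C * δ ^ dimE ρ) := by
  obtain ⟨-, hctop, hT⟩ := haarConstE_spec ρ hρ hinj hU
  have hc1top : haarConstE ρ + 1 ≠ ∞ := ENNReal.add_ne_top.2 ⟨hctop, ENNReal.one_ne_top⟩
  -- the ratio `σ(B(1,δ))/vol(b(0,δ))` is eventually `< haarConstE ρ + 1`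
  have hev : ∀ᶠ δ in 𝓝[>] (0 : ℝ), ballRatioE ρ δ < haarConstE ρ + 1 :=
    hT.eventually_lt_const (ENNReal.lt_add_right hctop one_ne_zero)
  obtain ⟨δ₀, hδ₀, hδ₀P⟩ : ∃ δ₀ : ℝ, 0 < δ₀ ∧ ∀ δ : ℝ, 0 < δ → δ < δ₀ →
      ballRatioE ρ δ < haarConstE ρ + 1 := by
    obtain ⟨b, hb, hsub⟩ := mem_nhdsGT_iff_exists_Ioo_subset.1 hev
    exact ⟨b, hb, fun δ hδ hδb => hsub ⟨hδ, hδb⟩⟩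
  have hV₁fin : volume (closedBall (0 : EuclideanSpace ℝ (Fin (dimE ρ))) 1) ≠ ∞ :=
    (volume_closedBall_fin_lt_top _ _).ne
  -- the constant: `(c_H + 1) vol(b(0,1))` for small radii plus `δ₀^{-D}` for large radii
  have hK0 : 0 ≤ (haarConstE ρ + 1).toReal *
      (volume (closedBall (0 : EuclideanSpace ℝ (Fin (dimE ρ))) 1)).toReal := by positivity
  refine ⟨(haarConstE ρ + 1).toReal *
      (volume (closedBall (0 : EuclideanSpace ℝ (Fin (dimE ρ))) 1)).toReal + δ₀⁻¹ ^ dimE ρ,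
    by positivity, fun δ hδ => ?_⟩
  rcases lt_or_ge δ δ₀ with hlt | hge
  · -- small radius: `σ(B(1,δ)) ≤ (c_H + 1) vol(b(0,δ)) = (c_H + 1) δ^D vol(b(0,1))`
    have h1 := (hδ₀P δ hδ hlt).le
    rw [ballRatioE, ENNReal.div_le_iff (volume_closedBall_fin_pos _ hδ).ne'
      (volume_closedBall_fin_lt_top _ _).ne, volume_closedBall_fin _ hδ.le] at h1
    calc haarProbability G {g : G | ‖ρ g - 1‖ ≤ δ}
        ≤ (haarConstE ρ + 1) * (ENNReal.ofReal (δ ^ dimE ρ) *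
            volume (closedBall (0 : EuclideanSpace ℝ (Fin (dimE ρ))) 1)) := h1
      _ = ENNReal.ofReal ((haarConstE ρ + 1).toReal *
            (volume (closedBall (0 : EuclideanSpace ℝ (Fin (dimE ρ))) 1)).toReal * δ ^ dimE ρ) := by
          rw [show (haarConstE ρ + 1).toReal *
              (volume (closedBall (0 : EuclideanSpace ℝ (Fin (dimE ρ))) 1)).toReal * δ ^ dimE ρ =
              (haarConstE ρ + 1).toReal * (δ ^ dimE ρ *
                (volume (closedBall (0 : EuclideanSpace ℝ (Fin (dimE ρ))) 1)).toReal) by ring,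
            ENNReal.ofReal_mul ENNReal.toReal_nonneg, ENNReal.ofReal_toReal hc1top,
            ENNReal.ofReal_mul (by positivity), ENNReal.ofReal_toReal hV₁fin]
      _ ≤ ENNReal.ofReal (((haarConstE ρ + 1).toReal *
            (volume (closedBall (0 : EuclideanSpace ℝ (Fin (dimE ρ))) 1)).toReal + δ₀⁻¹ ^ dimE ρ) *
              δ ^ dimE ρ) := by
          gcongr
          exact le_add_of_nonneg_right (by positivity)
  · -- large radius: `σ ≤ 1 ≤ (δ/δ₀)^D`
    calc haarProbability G {g : G | ‖ρ g - 1‖ ≤ δ} ≤ 1 := prob_le_one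
      _ = ENNReal.ofReal 1 := ENNReal.ofReal_one.symm
      _ ≤ ENNReal.ofReal (((haarConstE ρ + 1).toReal *
            (volume (closedBall (0 : EuclideanSpace ℝ (Fin (dimE ρ))) 1)).toReal + δ₀⁻¹ ^ dimE ρ) *
              δ ^ dimE ρ) := by
          apply ENNReal.ofReal_le_ofReal
          calc (1 : ℝ) ≤ (δ₀⁻¹ * δ) ^ dimE ρ :=
                one_le_pow₀ (by rwa [inv_mul_eq_div, one_le_div hδ₀])
            _ = δ₀⁻¹ ^ dimE ρ * δ ^ dimE ρ := mul_pow _ _ _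
            _ ≤ ((haarConstE ρ + 1).toReal *
                  (volume (closedBall (0 : EuclideanSpace ℝ (Fin (dimE ρ))) 1)).toReal +
                    δ₀⁻¹ ^ dimE ρ) * δ ^ dimE ρ := by
                gcongr
                exact le_add_of_nonneg_left hK0

end SmallBall

/-! ### The registered sub-goal: the one-link Laplace bound -/

/-- **One-link Laplace (Gaussian) upper bound** (registered wave-2 sub-goal of line `birth`, crux
`FemtoCurvatureTwoPointC`, stmt-QuantumFields-16204; the signature verbatim): for a compact group `G`
with a faithful continuous unitary representation `ρ : G →* M_N(ℂ)` there is `C > 0` with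
`∫_G e^{−β (N − Re tr ρ(g))} dσ(g) ≤ C β^{−D/2}` for all `β ≥ 1`, `D = dimE ρ`; in fact
`C = C₂ 2^{D/2} Γ(D/2 + 1)` with `C₂` the small-ball constant of `exists_haar_gball_le`. Layer cake
`∫ e^{−βS} dσ = ∫₀^∞ e^{−u} σ{S ≤ u/β} du` for `S = N − Re tr ρ = ‖ρ − 1‖²/2 ≥ 0`, the inclusion
`{S ≤ u/β} ⊆ B(1, √(2u/β))`, the small-ball bound and `∫₀^∞ u^{D/2} e^{−u} du = Γ(D/2 + 1)`. [folklore] -/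
theorem oneLinkLaplace_le_rpow :
    ∀ {N : ℕ} {G : Type} [Group G] [TopologicalSpace G] [IsTopologicalGroup G] [CompactSpace G]
        [MeasurableSpace G] [BorelSpace G] [SecondCountableTopology G] (ρ : G →* Matrix (Fin N) (Fin N) ℂ),
      Continuous ρ → Function.Injective ρ → (∀ g, ρ g ∈ Matrix.unitaryGroup (Fin N) ℂ) →
      ∃ C : ℝ, 0 < C ∧ ∀ β : ℝ, 1 ≤ β →
        ∫ g, Real.exp (-(β * ((N : ℝ) - (ρ g).trace.re))) ∂(haarProbability G) ≤
          C * β ^ (-((Summit.QuantumFields.YangMills.Theorems.FreeEnergyLogCoefficient.dimE ρ : ℝ) / 2)) := by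
  intro N G _ _ _ _ _ _ _ ρ hρ hinj hU
  obtain ⟨C₂, hC₂, hball⟩ := exists_haar_gball_le ρ hρ hinj hU
  -- the exponent `r = D/2`
  set r : ℝ := (dimE ρ : ℝ) / 2 with hr
  have hr0 : 0 ≤ r := by positivity
  -- the action `S = N - Re tr ρ ≥ 0` is measurable
  have hSm : Measurable fun g : G => (N : ℝ) - (ρ g).trace.re :=
    (continuous_const.sub (Complex.continuous_re.comp hρ.matrix_trace)).measurable
  have hS0 : ∀ g : G, 0 ≤ (N : ℝ) - (ρ g).trace.re := fun g => by
    rw [WeakCoupling.sub_re_trace_eq ρ hU]; positivity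
  refine ⟨C₂ * 2 ^ r * Real.Gamma (r + 1),
    mul_pos (mul_pos hC₂ (Real.rpow_pos_of_pos two_pos _)) (Real.Gamma_pos_of_pos (by positivity)),
    fun β hβ => ?_⟩
  have hβ0 : 0 < β := one_pos.trans_le hβ
  -- sublevel sets of `S` are Hilbert–Schmidt balls: `σ{S ≤ u/β} ≤ C₂ (2u/β)^{D/2}`
  have hV : ∀ u : ℝ, 0 < u →
      (haarProbability G {g : G | (N : ℝ) - (ρ g).trace.re ≤ u / β}).toReal ≤ C₂ * (2 * u / β) ^ r := by
    intro u hu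
    have hx : 0 ≤ 2 * u / β := by positivity
    have hδ : 0 < Real.sqrt (2 * u / β) := Real.sqrt_pos.2 (by positivity)
    have hsub : {g : G | (N : ℝ) - (ρ g).trace.re ≤ u / β} ⊆
        {g : G | ‖ρ g - 1‖ ≤ Real.sqrt (2 * u / β)} := by
      intro g hg
      rw [mem_setOf_eq, WeakCoupling.sub_re_trace_eq ρ hU, norm_sub_rev] at hg
      rw [mem_setOf_eq, Real.le_sqrt (norm_nonneg _) hx, mul_div_assoc]
      linarith
    have h2 := ENNReal.toReal_mono ENNReal.ofReal_ne_top ((measure_mono hsub).trans (hball _ hδ))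
    rw [ENNReal.toReal_ofReal (by positivity)] at h2
    have hδD : Real.sqrt (2 * u / β) ^ dimE ρ = (2 * u / β) ^ r := by
      rw [Real.sqrt_eq_rpow, ← Real.rpow_natCast, ← Real.rpow_mul hx, hr]
      congr 1; ring
    rwa [hδD] at h2
  -- pointwise bound of the layer-cake integrand by a Gamma integrand
  have hpt : ∀ u ∈ Ioi (0 : ℝ),
      Real.exp (-u) * (haarProbability G {g : G | (N : ℝ) - (ρ g).trace.re ≤ u / β}).toReal ≤
        C₂ * 2 ^ r * β ^ (-r) * u ^ r * Real.exp (-u) := by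
    intro u hu
    have hu0 : 0 < u := hu
    have hsplit : (2 * u / β) ^ r = 2 ^ r * β ^ (-r) * u ^ r := by
      rw [Real.div_rpow (by positivity) hβ0.le, Real.mul_rpow (by norm_num) hu0.le,
        Real.rpow_neg hβ0.le]
      ring
    calc Real.exp (-u) * (haarProbability G {g : G | (N : ℝ) - (ρ g).trace.re ≤ u / β}).toReal
        ≤ Real.exp (-u) * (C₂ * (2 * u / β) ^ r) :=
          mul_le_mul_of_nonneg_left (hV u hu0) (Real.exp_pos _).le
      _ = C₂ * 2 ^ r * β ^ (-r) * u ^ r * Real.exp (-u) := by rw [hsplit]; ring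
  -- the Gamma integrand is integrable
  have hint : IntegrableOn (fun u : ℝ => C₂ * 2 ^ r * β ^ (-r) * u ^ r * Real.exp (-u)) (Ioi 0) := by
    have h : IntegrableOn (fun u : ℝ => C₂ * 2 ^ r * β ^ (-r) * (Real.exp (-u) * u ^ (r + 1 - 1)))
        (Ioi 0) :=
      (Real.GammaIntegral_convergent (s := r + 1) (by positivity)).const_mul (C₂ * 2 ^ r * β ^ (-r))
    refine h.congr_fun (fun u _ => ?_) measurableSet_Ioi
    rw [add_sub_cancel_right]; ring
  calc ∫ g, Real.exp (-(β * ((N : ℝ) - (ρ g).trace.re))) ∂(haarProbability G)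
      = ∫ u in Ioi (0 : ℝ), Real.exp (-u) *
          (haarProbability G {g : G | (N : ℝ) - (ρ g).trace.re ≤ u / β}).toReal :=
        LaplacePowerLog.integral_exp_neg_mul_eq hSm hS0 hβ0
    _ ≤ ∫ u in Ioi (0 : ℝ), C₂ * 2 ^ r * β ^ (-r) * u ^ r * Real.exp (-u) := by
        refine integral_mono_of_nonneg (Eventually.of_forall fun u =>
          mul_nonneg (Real.exp_pos _).le ENNReal.toReal_nonneg) hint ?_
        filter_upwards [ae_restrict_mem measurableSet_Ioi] with u hu using hpt u hu
    _ = C₂ * 2 ^ r * β ^ (-r) * Real.Gamma (r + 1) :=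
        LaplacePowerLog.integral_const_mul_rpow_mul_exp_neg hr0 _
    _ = C₂ * 2 ^ r * Real.Gamma (r + 1) * β ^ (-r) := by ring

end Summit.QuantumFields.YangMills.Theorems.FemtoCurvatureTwoPointC

end
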